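import Summits.PneNP.PneNP.Theorems.PhaseTwinsPolyDepthTwinsAboveConnectorIndep
import Summits.PneNP.PneNP.Theorems.PhaseTwinsPolyDepthTwinsAboveMaxDegree

/-!
# Route PhaseTwins, crux `PolyDepthTwinsAbove` (stmt-PneNP-2719), line `parity-wired-ports`:
# `stub_connector`, part 3 — the pattern factor under the product measures

The port computation of Sly's Lemma 2.2 for the parity wiring: under the product measures `Q^{Y_g}`
on the ports of the `6M` copies (a `V⁺` port of copy `g` occupied with probability `q⁺` in phase `+`
and `q⁻` in phase `−`, a `V⁻` port the other way round), the pattern factor averages to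
`pwW c Y · (1+λ)^{10 M κ₂}` (`sum_pwPatFactor_portLaw`): the pair edges contribute
`pairW = ((1-q_s q_t)(1-q'_s q'_t))^{κ₁}` per canonical dart (the tree's
`SlyReduction.sum_bernoulliWeight_noPair`), and every complex the polynomial `cxWeight (c w) λ x` at
the vacancy probabilities of the six (distinct!) ports its ends plug into — all factors read pairwise
disjoint sets of ports (`slot`, `Vp`/`Vm`, `canonEnd_injective` from the degree file), so the expectation factorises
(marginalisation `sum_bw_marginal`, splitting `sum_bw_sum_mul` / `sum_bw_prod_split`).
[cite: Sly2010, Lemma 2.2 (proof, last two displays); folklore]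
-/

noncomputable section

open scoped Classical BigOperators

namespace Summit.PneNP.PneNP.Cruxes.PolyDepthTwinsAbove.ParityWiredPorts

open Finset
open Literature.Computability.Complexity (portLaw SlyReduction.sum_bernoulliWeight
  SlyReduction.sum_bernoulliWeight_noPair)
open Literature.Computability.Complexity.Expander (RotGraph)
open Literature.ModelTheory.FiniteModelTheory.TseitinColouring (Dart)
open Literature.ModelTheory.FiniteModelTheory.CFIMatching (Canon)

set_option linter.dupNamespace false

variable {M v m κ₁ κ₂ : ℕ}

/-! ## Two more Bernoulli tools -/

/-- Indicators of equivalent events agree (for ANY decidability instances). -/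
theorem ite_congr_of_iff {P Q : Prop} {instP : Decidable P} {instQ : Decidable Q} (h : P ↔ Q) (a b : ℝ) :
    @ite ℝ P instP a b = @ite ℝ Q instQ a b := by
  by_cases hP : P
  · rw [if_pos hP, if_pos (h.1 hP)]
  · rw [if_neg hP, if_neg (fun hQ => hP (h.2 hQ))]


/-- **Splitting a Bernoulli sum of a product integrand over a sum of coordinate types.** -/
theorem sum_bw_sum_mul {C₁ C₂ : Type*} [Fintype C₁] [Fintype C₂] [DecidableEq C₁] [DecidableEq C₂]
    (p : C₁ ⊕ C₂ → ℝ) (G₁ : Finset C₁ → ℝ) (G₂ : Finset C₂ → ℝ) :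
    ∑ t : Finset (C₁ ⊕ C₂), ((∏ c ∈ t, p c) * ∏ c ∈ tᶜ, (1 - p c)) * (G₁ t.toLeft * G₂ t.toRight) =
      (∑ t₁ : Finset C₁, ((∏ c ∈ t₁, p (Sum.inl c)) * ∏ c ∈ t₁ᶜ, (1 - p (Sum.inl c))) * G₁ t₁) *
        ∑ t₂ : Finset C₂, ((∏ c ∈ t₂, p (Sum.inr c)) * ∏ c ∈ t₂ᶜ, (1 - p (Sum.inr c))) * G₂ t₂ := by
  rw [sum_mul_sum, ← Fintype.sum_prod_type']
  refine Fintype.sum_equiv Finset.sumEquiv.toEquiv _ _ fun t => ?_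
  simp only [RelIso.coe_fn_toEquiv, Finset.sumEquiv_apply_fst, Finset.sumEquiv_apply_snd]
  rw [bw_sum_split]
  ring

/-- **The local factor under the product measure**: if the ports `l` are vacant independently with
probability `1 - p l`, the expected complex factor at the vacancy INDICATORS is the complex factor at
the vacancy PROBABILITIES (`cxWeight` is multilinear in the vacancies of distinct ports). -/
theorem sum_bw_cxWeight {L : Type*} [Fintype L] [DecidableEq L] (ι : Fin 3 × ZMod 2 → L)
    (hι : Function.Injective ι) (p : L → ℝ) (e : ZMod 2) (lam : ℝ) :
    ∑ s : Finset L, ((∏ l ∈ s, p l) * ∏ l ∈ sᶜ, (1 - p l)) *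
        cxWeight e lam (fun q => if ι q ∈ s then 0 else 1) =
      cxWeight e lam fun q => 1 - p (ι q) := by
  unfold cxWeight
  simp_rw [Finset.mul_sum]
  rw [Finset.sum_comm]
  refine sum_congr rfl fun J _ => ?_
  by_cases hJ : (cxGraph e).IsIndepSet (↑J : Set CxVert)
  · simp_rw [if_pos hJ]
    -- the end factor is the indicator that the ports of the occupied ends are vacant
    have hind : ∀ s : Finset L,
        (∏ q : Fin 3 × ZMod 2, (if (Sum.inl q : CxVert) ∈ J then (if ι q ∈ s then (0 : ℝ) else 1) else 1)) =
          if Disjoint ((univ.filter fun q : Fin 3 × ZMod 2 => (Sum.inl q : CxVert) ∈ J).image ι) s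
          then 1 else 0 := by
      intro s
      by_cases hd : Disjoint ((univ.filter fun q : Fin 3 × ZMod 2 => (Sum.inl q : CxVert) ∈ J).image ι) s
      · rw [if_pos hd]
        refine prod_eq_one fun q _ => ?_
        by_cases h1 : (Sum.inl q : CxVert) ∈ J
        · have h2 : ι q ∉ s := by
            intro h2
            exact Finset.disjoint_left.1 hd (mem_image_of_mem ι (by simp [h1])) h2
          rw [if_pos h1, if_neg h2]
        · rw [if_neg h1]
      · rw [if_neg hd]
        obtain ⟨x, hx1, hx2⟩ := not_disjoint_iff.1 hd
        obtain ⟨q, hq, rfl⟩ := mem_image.1 hx1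
        simp only [mem_filter, mem_univ, true_and] at hq
        exact prod_eq_zero (mem_univ q) (by rw [if_pos hq, if_pos hx2])
    have hrw : ∀ s : Finset L, ((∏ l ∈ s, p l) * ∏ l ∈ sᶜ, (1 - p l)) *
        (lam ^ J.card * ∏ q : Fin 3 × ZMod 2, (if (Sum.inl q : CxVert) ∈ J then (if ι q ∈ s then (0 : ℝ) else 1) else 1)) =
        lam ^ J.card * (((∏ l ∈ s, p l) * ∏ l ∈ sᶜ, (1 - p l)) *
          if Disjoint ((univ.filter fun q : Fin 3 × ZMod 2 => (Sum.inl q : CxVert) ∈ J).image ι) s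
          then 1 else 0) := by
      intro s; rw [hind s]; ring
    simp_rw [hrw]
    rw [← Finset.mul_sum, sum_bw_disjoint, prod_image (fun q _ q' _ h => hι h)]
    congr 1
    rw [prod_filter]
  · simp_rw [if_neg hJ, mul_zero, sum_const_zero]

/-! ## The `V⁻` side: pair edges only -/

/-- Weights of a family of port configurations as a Bernoulli weight on `(copy) × (port)`. -/
theorem prod_pow_card_fib_eq_bw (b : (Dart M 3 × ZMod 2) → ℝ) (t : Finset ((Dart M 3 × ZMod 2) × Fin m)) :
    ∏ g : Dart M 3 × ZMod 2, b g ^ (univ.filter fun i : Fin m => (g, i) ∈ t).card *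
        (1 - b g) ^ (m - (univ.filter fun i : Fin m => (g, i) ∈ t).card) =
      (∏ c ∈ t, b c.1) * ∏ c ∈ tᶜ, (1 - b c.1) := by
  rw [prod_mem_eq_prod_pow_fib t b, prod_mem_eq_prod_pow_fib tᶜ fun g => 1 - b g, ← prod_mul_distrib]
  refine prod_congr rfl fun g _ => ?_
  rw [fib_compl, card_compl, Fintype.card_fin]

/-- **Pair edges on one side under the product measure**: the probability that no canonical dart has a
pair slot occupied in both copies is `Π_{δ canonical} (1 - b_{δ,0} b_{δ,1})^{κ₁}`. -/
theorem sum_pairSide (R : RotGraph M 3) (W : Wiring v m κ₁ κ₂) (b : (Dart M 3 × ZMod 2) → ℝ) :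
    ∑ S : (Dart M 3 × ZMod 2) → Finset (Fin m),
      (∏ g : Dart M 3 × ZMod 2, b g ^ (S g).card * (1 - b g) ^ (m - (S g).card)) *
        (if ∀ δ : Dart M 3, Canon R δ → ∀ j : Fin κ₁,
          ¬ (W.slot (Sum.inl j) ∈ S (δ, 0) ∧ W.slot (Sum.inl j) ∈ S (δ, 1)) then (1 : ℝ) else 0) =
      ∏ δ : Dart M 3, if Canon R δ then (1 - b (δ, 0) * b (δ, 1)) ^ κ₁ else 1 := by
  rw [← sum_eq_sum_fib (fun S : (Dart M 3 × ZMod 2) → Finset (Fin m) =>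
    (∏ g : Dart M 3 × ZMod 2, b g ^ (S g).card * (1 - b g) ^ (m - (S g).card)) *
      (if ∀ δ : Dart M 3, Canon R δ → ∀ j : Fin κ₁,
        ¬ (W.slot (Sum.inl j) ∈ S (δ, 0) ∧ W.slot (Sum.inl j) ∈ S (δ, 1)) then (1 : ℝ) else 0))]
  have key := SlyReduction.sum_bernoulliWeight_noPair (fun c : (Dart M 3 × ZMod 2) × Fin m => b c.1)
    ((univ.filter fun δ : Dart M 3 => Canon R δ) ×ˢ (univ : Finset (Fin κ₁)))
    (fun e => ((e.1, (0 : ZMod 2)), W.slot (Sum.inl e.2)))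
    (fun e => ((e.1, (1 : ZMod 2)), W.slot (Sum.inl e.2))) ?_ ?_ ?_
  · rw [prod_product, prod_filter] at key
    simp only [prod_const, card_univ, Fintype.card_fin] at key
    rw [← key]
    refine sum_congr rfl fun t _ => ?_
    dsimp only
    rw [prod_pow_card_fib_eq_bw]
    congr 1
    refine ite_congr_of_iff ⟨fun h e he => ?_, fun h δ hδ j => ?_⟩ 1 0
    · rw [mem_product, mem_filter] at he
      have := h e.1 he.1.2 e.2
      simpa only [mem_filter, mem_univ, true_and] using this
    · have := h (δ, j) (by simp [hδ])
      simpa only [mem_filter, mem_univ, true_and] using this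
  · rintro ⟨δ, j⟩ - ⟨δ', j'⟩ - h
    simp only [Prod.mk.injEq] at h
    obtain ⟨⟨rfl, -⟩, h2⟩ := h
    have := W.slot.injective h2
    simp only [Sum.inl.injEq] at this
    subst this
    rfl
  · rintro ⟨δ, j⟩ - ⟨δ', j'⟩ - h
    simp only [Prod.mk.injEq] at h
    obtain ⟨⟨rfl, -⟩, h2⟩ := h
    have := W.slot.injective h2
    simp only [Sum.inl.injEq] at this
    subst this
    rfl
  · rintro ⟨δ, j⟩ - ⟨δ', j'⟩ - h
    simp only [Prod.mk.injEq] at h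
    exact absurd h.1.2 (by decide)

/-! ## The `V⁺` side: pair edges and complexes -/

/-- The used `V⁺` coordinates: pair slots of the two copies of the canonical darts, and the end slots of
the complexes; they are pairwise distinct. -/
theorem usedPort_injective (R : RotGraph M 3) (W : Wiring v m κ₁ κ₂) :
    Function.Injective (fun u : ({δ : Dart M 3 // Canon R δ} × Fin κ₁ × ZMod 2) ⊕
        ((Fin M × Fin κ₂) × (Fin 3 × ZMod 2)) =>
      (match u with
        | Sum.inl (δ, j, a) => (((δ.1, a) : Dart M 3 × ZMod 2), W.slot (Sum.inl j))
        | Sum.inr (k, l) => ((((canonEnd R (k.1, l.1)).1, l.2) : Dart M 3 × ZMod 2),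
            W.slot (Sum.inr ((canonEnd R (k.1, l.1)).2, k.2))) :
          (Dart M 3 × ZMod 2) × Fin m)) := by
  rintro (⟨δ, j, a⟩ | ⟨k, l⟩) (⟨δ', j', a'⟩ | ⟨k', l'⟩) h <;>
    simp only [Prod.mk.injEq] at h
  · obtain ⟨⟨h1, rfl⟩, h2⟩ := h
    have := W.slot.injective h2
    simp only [Sum.inl.injEq] at this
    subst this
    rw [Subtype.ext h1]
  · exact absurd (W.slot.injective h.2) (by simp)
  · exact absurd (W.slot.injective h.2) (by simp)
  · obtain ⟨⟨h1, h1'⟩, h2⟩ := h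
    have h3 := W.slot.injective h2
    simp only [Sum.inr.injEq, Prod.mk.injEq] at h3
    obtain ⟨h3, h4⟩ := h3
    have h5 : canonEnd R (k.1, l.1) = canonEnd R (k'.1, l'.1) := Prod.ext h1 h3
    have h6 := canonEnd_injective R h5
    simp only [Prod.mk.injEq] at h6
    obtain ⟨h6, h7⟩ := h6
    rw [Prod.ext h6 h4, Prod.ext h7 h1']

/-- **Pair edges and complexes on the `V⁺` side under the product measure**: the pair indicator times
the complex factors at the vacancy indicators average to `Π_{δ canonical} (1 - a_{δ,0} a_{δ,1})^{κ₁}` times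
the complex factors at the vacancy probabilities. -/
theorem sum_plusSide (R : RotGraph M 3) (W : Wiring v m κ₁ κ₂) (a : (Dart M 3 × ZMod 2) → ℝ)
    (c : Fin M → ZMod 2) (lam : ℝ) :
    ∑ S : (Dart M 3 × ZMod 2) → Finset (Fin m),
      (∏ g : Dart M 3 × ZMod 2, a g ^ (S g).card * (1 - a g) ^ (m - (S g).card)) *
        ((if ∀ δ : Dart M 3, Canon R δ → ∀ j : Fin κ₁,
            ¬ (W.slot (Sum.inl j) ∈ S (δ, 0) ∧ W.slot (Sum.inl j) ∈ S (δ, 1)) then (1 : ℝ) else 0) *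
          ∏ k : Fin M × Fin κ₂, cxWeight (c k.1) lam fun l =>
            if W.slot (Sum.inr ((canonEnd R (k.1, l.1)).2, k.2)) ∈ S ((canonEnd R (k.1, l.1)).1, l.2)
            then 0 else 1) =
      (∏ δ : Dart M 3, if Canon R δ then (1 - a (δ, 0) * a (δ, 1)) ^ κ₁ else 1) *
        ∏ k : Fin M × Fin κ₂, cxWeight (c k.1) lam fun l => 1 - a ((canonEnd R (k.1, l.1)).1, l.2) := by
  -- as a Bernoulli sum over configurations of `(copy) × (port)`
  rw [← sum_eq_sum_fib (fun S : (Dart M 3 × ZMod 2) → Finset (Fin m) =>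
    (∏ g : Dart M 3 × ZMod 2, a g ^ (S g).card * (1 - a g) ^ (m - (S g).card)) *
      ((if ∀ δ : Dart M 3, Canon R δ → ∀ j : Fin κ₁,
          ¬ (W.slot (Sum.inl j) ∈ S (δ, 0) ∧ W.slot (Sum.inl j) ∈ S (δ, 1)) then (1 : ℝ) else 0) *
        ∏ k : Fin M × Fin κ₂, cxWeight (c k.1) lam fun l =>
          if W.slot (Sum.inr ((canonEnd R (k.1, l.1)).2, k.2)) ∈ S ((canonEnd R (k.1, l.1)).1, l.2)
          then 0 else 1))]
  -- the integrand reads only the used coordinates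
  let κ : ({δ : Dart M 3 // Canon R δ} × Fin κ₁ × ZMod 2) ⊕ ((Fin M × Fin κ₂) × (Fin 3 × ZMod 2)) →
      (Dart M 3 × ZMod 2) × Fin m := fun u => match u with
    | Sum.inl (δ, j, a) => ((δ.1, a), W.slot (Sum.inl j))
    | Sum.inr (k, l) => (((canonEnd R (k.1, l.1)).1, l.2), W.slot (Sum.inr ((canonEnd R (k.1, l.1)).2, k.2)))
  have hκ : Function.Injective κ := usedPort_injective R W
  let G : Finset (({δ : Dart M 3 // Canon R δ} × Fin κ₁ × ZMod 2) ⊕ ((Fin M × Fin κ₂) × (Fin 3 × ZMod 2))) → ℝ :=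
    fun τ => (if ∀ (δ : {δ : Dart M 3 // Canon R δ}) (j : Fin κ₁),
        ¬ (Sum.inl (δ, j, (0 : ZMod 2)) ∈ τ ∧ Sum.inl (δ, j, (1 : ZMod 2)) ∈ τ) then (1 : ℝ) else 0) *
      ∏ k : Fin M × Fin κ₂, cxWeight (c k.1) lam fun l => if Sum.inr (k, l) ∈ τ then 0 else 1
  have hG : ∀ t : Finset ((Dart M 3 × ZMod 2) × Fin m),
      ((if ∀ δ : Dart M 3, Canon R δ → ∀ j : Fin κ₁,
          ¬ (W.slot (Sum.inl j) ∈ (univ.filter fun i : Fin m => ((δ, (0 : ZMod 2)), i) ∈ t) ∧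
             W.slot (Sum.inl j) ∈ (univ.filter fun i : Fin m => ((δ, (1 : ZMod 2)), i) ∈ t)) then (1 : ℝ) else 0) *
        ∏ k : Fin M × Fin κ₂, cxWeight (c k.1) lam fun l =>
          if W.slot (Sum.inr ((canonEnd R (k.1, l.1)).2, k.2)) ∈
              (univ.filter fun i : Fin m => ((((canonEnd R (k.1, l.1)).1, l.2) : Dart M 3 × ZMod 2), i) ∈ t)
          then 0 else 1) = G (univ.filter fun u => κ u ∈ t) := by
    intro t
    simp only [G, κ, mem_filter, mem_univ, true_and]
    congr 1
    refine ite_congr_of_iff ?_ 1 0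
    exact ⟨fun h δ j => h δ.1 δ.2 j, fun h δ hδ j => h ⟨δ, hδ⟩ j⟩
  have hw : ∀ t : Finset ((Dart M 3 × ZMod 2) × Fin m),
      ∏ g : Dart M 3 × ZMod 2, a g ^ (univ.filter fun i : Fin m => (g, i) ∈ t).card *
          (1 - a g) ^ (m - (univ.filter fun i : Fin m => (g, i) ∈ t).card) =
        (∏ c ∈ t, a c.1) * ∏ c ∈ tᶜ, (1 - a c.1) := prod_pow_card_fib_eq_bw a
  simp_rw [hw, hG]
  rw [sum_bw_marginal κ hκ (fun c => a c.1) G]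
  -- split pair slots from end slots
  simp only [G]
  have hsplit := sum_bw_sum_mul (fun u => a (κ u).1)
    (fun τ₁ : Finset ({δ : Dart M 3 // Canon R δ} × Fin κ₁ × ZMod 2) =>
      if ∀ (δ : {δ : Dart M 3 // Canon R δ}) (j : Fin κ₁), ¬ ((δ, j, (0 : ZMod 2)) ∈ τ₁ ∧ (δ, j, (1 : ZMod 2)) ∈ τ₁)
      then (1 : ℝ) else 0)
    (fun τ₂ : Finset ((Fin M × Fin κ₂) × (Fin 3 × ZMod 2)) =>
      ∏ k : Fin M × Fin κ₂, cxWeight (c k.1) lam fun l => if (k, l) ∈ τ₂ then 0 else 1)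
  simp only [mem_toLeft, mem_toRight] at hsplit
  rw [hsplit]
  congr 1
  · -- pair slots: no pair doubly occupied
    have key := SlyReduction.sum_bernoulliWeight_noPair (fun u : {δ : Dart M 3 // Canon R δ} × Fin κ₁ × ZMod 2 =>
        a (κ (Sum.inl u)).1) (univ : Finset ({δ : Dart M 3 // Canon R δ} × Fin κ₁))
      (fun e => (e.1, e.2, (0 : ZMod 2))) (fun e => (e.1, e.2, (1 : ZMod 2))) ?_ ?_ ?_
    · have hT : (∏ δ : Dart M 3, if Canon R δ then (1 - a (δ, 0) * a (δ, 1)) ^ κ₁ else 1) =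
          ∏ x : {δ : Dart M 3 // Canon R δ}, (1 - a (x.1, 0) * a (x.1, 1)) ^ κ₁ := by
        rw [← prod_subtype (univ.filter fun δ : Dart M 3 => Canon R δ) (by simp)
          (fun δ : Dart M 3 => (1 - a (δ, 0) * a (δ, 1)) ^ κ₁), prod_filter]
      rw [hT]
      rw [Fintype.prod_prod_type] at key
      simp only [mem_univ, true_implies, prod_const, card_univ, Fintype.card_fin, κ] at key
      rw [← key]
      refine sum_congr rfl fun τ₁ _ => ?_
      congr 1
      refine ite_congr_of_iff ?_ 1 0
      exact ⟨fun h e => h e.1 e.2, fun h δ j => h (δ, j)⟩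
    · rintro ⟨δ, j⟩ - ⟨δ', j'⟩ - h
      simp only [Prod.mk.injEq] at h
      rw [h.1, h.2.1]
    · rintro ⟨δ, j⟩ - ⟨δ', j'⟩ - h
      simp only [Prod.mk.injEq] at h
      rw [h.1, h.2.1]
    · rintro ⟨δ, j⟩ - ⟨δ', j'⟩ - h
      simp only [Prod.mk.injEq] at h
      exact absurd h.2.2 (by decide)
  · -- end slots: complex by complex
    have hfun : ∀ τ₂ : Finset ((Fin M × Fin κ₂) × (Fin 3 × ZMod 2)),
        (∏ k : Fin M × Fin κ₂, cxWeight (c k.1) lam fun l => if (k, l) ∈ τ₂ then 0 else 1) =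
          ∏ k : Fin M × Fin κ₂, cxWeight (c k.1) lam fun l =>
            if l ∈ (univ.filter fun l => (k, l) ∈ τ₂) then 0 else 1 := by
      intro τ₂
      refine prod_congr rfl fun k _ => ?_
      congr 1
      funext l
      simp only [mem_filter, mem_univ, true_and]
    simp_rw [hfun]
    rw [sum_bw_prod_split (fun u : (Fin M × Fin κ₂) × (Fin 3 × ZMod 2) => a (κ (Sum.inr u)).1)
      (fun k s => cxWeight (c k.1) lam fun l => if l ∈ s then 0 else 1)]
    refine prod_congr rfl fun k _ => ?_
    have h1 := sum_bw_cxWeight (id : Fin 3 × ZMod 2 → Fin 3 × ZMod 2) Function.injective_id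
      (fun l => a (κ (Sum.inr (k, l))).1) (c k.1) lam
    simp only [id, κ] at h1 ⊢
    exact h1

/-! ## Assembly: the pattern factor averages to `pwW · (1+λ)^{10 M κ₂}` -/

/-- The ends and inner vertices number `10 M κ₂`. -/
theorem card_cxPart (M κ₂ : ℕ) :
    Fintype.card ((Fin M × Fin 3 × ZMod 2 × Fin κ₂) ⊕ (Fin M × (Fin 2 → ZMod 2) × Fin κ₂)) = 10 * M * κ₂ := by
  simp only [Fintype.card_sum, Fintype.card_prod, Fintype.card_fin, ZMod.card, Fintype.card_fun]
  ring

/-- **The port computation of Lemma 2.2 for the parity wiring.** Under the product measures `Q^{Y_g}` the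
pattern factor averages to the explicit weight: `Σ_P pwPatFactor P · Π_g Q^{Y_g}(P g) = pwW c Y · (1+λ)^{10Mκ₂}`. -/
theorem sum_pwPatFactor_portLaw (R : RotGraph M 3) (W : Wiring v m κ₁ κ₂) {lam : ℝ} (hlam : 0 ≤ lam)
    (qp qm : ℝ) (c : Fin M → ZMod 2) (Y : Dart M 3 × ZMod 2 → Bool) :
    ∑ P : Dart M 3 × ZMod 2 → Finset (Fin m) × Finset (Fin m),
      pwPatFactor R W lam c P *
        ∏ g : Dart M 3 × ZMod 2, portLaw (if Y g then qp else qm) (if Y g then qm else qp) m (P g) =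
      pwW R lam qp qm κ₁ κ₂ c Y *
        (1 + lam) ^ Fintype.card ((Fin M × Fin 3 × ZMod 2 × Fin κ₂) ⊕ (Fin M × (Fin 2 → ZMod 2) × Fin κ₂)) := by
  -- the two occupation probabilities of copy `g`
  set a : Dart M 3 × ZMod 2 → ℝ := fun g => if Y g then qp else qm with ha
  set b : Dart M 3 × ZMod 2 → ℝ := fun g => if Y g then qm else qp with hb
  -- split the families of port configurations into their `V⁺` and `V⁻` halves
  have hsum : ∑ P : Dart M 3 × ZMod 2 → Finset (Fin m) × Finset (Fin m),
      pwPatFactor R W lam c P * ∏ g : Dart M 3 × ZMod 2, portLaw (a g) (b g) m (P g) =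
      (∑ S : (Dart M 3 × ZMod 2) → Finset (Fin m),
        (∏ g : Dart M 3 × ZMod 2, a g ^ (S g).card * (1 - a g) ^ (m - (S g).card)) *
          ((if ∀ δ : Dart M 3, Canon R δ → ∀ j : Fin κ₁,
              ¬ (W.slot (Sum.inl j) ∈ S (δ, 0) ∧ W.slot (Sum.inl j) ∈ S (δ, 1)) then (1 : ℝ) else 0) *
            ∏ k : Fin M × Fin κ₂, cxWeight (c k.1) lam fun l =>
              if W.slot (Sum.inr ((canonEnd R (k.1, l.1)).2, k.2)) ∈ S ((canonEnd R (k.1, l.1)).1, l.2)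
              then 0 else 1)) *
      ∑ S : (Dart M 3 × ZMod 2) → Finset (Fin m),
        (∏ g : Dart M 3 × ZMod 2, b g ^ (S g).card * (1 - b g) ^ (m - (S g).card)) *
          (if ∀ δ : Dart M 3, Canon R δ → ∀ j : Fin κ₁,
            ¬ (W.slot (Sum.inl j) ∈ S (δ, 0) ∧ W.slot (Sum.inl j) ∈ S (δ, 1)) then (1 : ℝ) else 0) := by
    rw [sum_mul_sum, ← Fintype.sum_prod_type']
    refine Fintype.sum_equiv (Equiv.arrowProdEquivProdArrow _ _ _) _ _ fun P => ?_
    simp only [Equiv.arrowProdEquivProdArrow, Equiv.coe_fn_mk]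
    unfold pwPatFactor portLaw
    rw [prod_mul_distrib]
    by_cases hA : ∀ δ : Dart M 3, Canon R δ → ∀ j : Fin κ₁,
        ¬ (W.slot (Sum.inl j) ∈ (P (δ, 0)).1 ∧ W.slot (Sum.inl j) ∈ (P (δ, 1)).1)
    · by_cases hB : ∀ δ : Dart M 3, Canon R δ → ∀ j : Fin κ₁,
          ¬ (W.slot (Sum.inl j) ∈ (P (δ, 0)).2 ∧ W.slot (Sum.inl j) ∈ (P (δ, 1)).2)
      · rw [if_pos (fun δ hδ j => ⟨hA δ hδ j, hB δ hδ j⟩), if_pos hA, if_pos hB]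
        ring
      · rw [if_neg (fun h => hB fun δ hδ j => (h δ hδ j).2), if_neg hB]
        ring
    · rw [if_neg (fun h => hA fun δ hδ j => (h δ hδ j).1), if_neg hA]
      ring
  rw [hsum, sum_plusSide, sum_pairSide]
  -- identify with `pwW · (1+λ)^{10 M κ₂}`
  have hD : (0 : ℝ) < (1 + lam) ^ 10 := pow_pos (by linarith) 10
  have hcx : ∏ k : Fin M × Fin κ₂, cxWeight (c k.1) lam (fun l => 1 - a ((canonEnd R (k.1, l.1)).1, l.2)) =
      (∏ w : Fin M, cxW lam qp qm (c w) (fun p => Y ((canonEnd R (w, p.1)).1, p.2)) ^ κ₂) *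
        (1 + lam) ^ Fintype.card ((Fin M × Fin 3 × ZMod 2 × Fin κ₂) ⊕ (Fin M × (Fin 2 → ZMod 2) × Fin κ₂)) := by
    rw [Fintype.prod_prod_type]
    simp only [prod_const, card_univ, Fintype.card_fin]
    rw [card_cxPart, show 10 * M * κ₂ = (10 * κ₂) * M by ring, pow_mul,
      show ((1 + lam) ^ (10 * κ₂)) ^ M = ∏ _w : Fin M, (1 + lam) ^ (10 * κ₂) by
        rw [prod_const, card_univ, Fintype.card_fin], ← prod_mul_distrib]
    refine prod_congr rfl fun w _ => ?_
    rw [pow_mul, ← mul_pow]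
    congr 1
    rw [cxW, div_mul_cancel₀ _ hD.ne']
    rfl
  have hpair : (∏ δ : Dart M 3, if Canon R δ then (1 - a (δ, 0) * a (δ, 1)) ^ κ₁ else 1) *
      (∏ δ : Dart M 3, if Canon R δ then (1 - b (δ, 0) * b (δ, 1)) ^ κ₁ else 1) =
      ∏ δ : Dart M 3, if Canon R δ then pairW qp qm κ₁ (Y (δ, 0)) (Y (δ, 1)) else 1 := by
    rw [← prod_mul_distrib]
    refine prod_congr rfl fun δ _ => ?_
    by_cases hC : Canon R δ
    · rw [if_pos hC, if_pos hC, if_pos hC, pairW, mul_pow]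
      rfl
    · rw [if_neg hC, if_neg hC, if_neg hC, mul_one]
  rw [pwW, ← hpair, hcx]
  ring

end Summit.PneNP.PneNP.Cruxes.PolyDepthTwinsAbove.ParityWiredPorts
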